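import Literature.AlgebraicGeometry.Resolution.HenselizedFunctionFieldsLemma55
import Literature.AlgebraicGeometry.Resolution.HenselizedFunctionFieldsImmediateProofs
import Literature.AlgebraicGeometry.Resolution.NormalDegreePDefectlessInseparable
import HarnessLib

/-!
# Kuhlmann 2010, Lemma 5.5 (`Kuhlmann2010FiniteExtensionInertiallyGenerated`): the remaining trust base

Topic: `Literature/AlgebraicGeometry/Resolution` (valued function fields). Bookkeeping for the
named fact `Kuhlmann2010FiniteExtensionInertiallyGenerated` (`HenselizedFunctionFields.lean`) =
F.-V. Kuhlmann, *Elimination of ramification I: The generalized stability theorem*, Trans. AMS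
362 (2010) 5697–5727 = arXiv:1003.5678, **Lemma 5.5** as applied on p. 20 ("From the preceding
lemma we infer that `E'` is again a henselized inertially generated function field of rank 1 and
transcendence degree 1 with a valuation-transcendental generator over `K`"), after the
discharges now in the tree:

* Lemma 5.5, Case II, is PROVED from the displayed statement of p. 19 ("*Henselized inertially
  generated function fields … do not admit proper immediate algebraic extensions*",
  `Kuhlmann2010NoImmediateExtensionRT`) and Hensel's Lemma (`Kuhlmann2010HenselsLemma`):
  `Kuhlmann2010FiniteExtensionInertiallyGenerated.of_parts` (`HenselizedFunctionFieldsLemma55.lean`);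
* Hensel's Lemma for henselian fields in the uniqueness sense is PROVED:
  `Kuhlmann2010HenselsLemma_holds` (`HenselsLemmaProofs.lean`);
* the displayed statement of p. 19 is PROVED from the reduction to a tower of normal extensions
  of degree `p` (`Kuhlmann2010TameTowerReduction`, pp. 18–19 with Lemma 2.27) and Cor. 4.2 /
  Prop. 3.1 for its first step (`Kuhlmann2010NormalDegreePDefectless`):
  `Kuhlmann2010NoImmediateExtensionRT.of_parts₂` (`HenselizedFunctionFieldsImmediateProofs.lean`)
  — Prop. 2.18 (`Kuhlmann2010DefectUnramifiedBaseChange_holds`,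
  `HenselizedFunctionFieldsBaseChangeProofs.lean`) is no longer needed there;
* the purely inseparable steps (Prop. 3.1 with Thm. 2.14, Lemma 2.3) are PROVED, so that
  `Kuhlmann2010NormalDegreePDefectless` rests on Cor. 4.2 alone:
  `Kuhlmann2010NormalDegreePDefectless.of_galois` (`NormalDegreePDefectlessInseparable.lean`).

Hence (`Kuhlmann2010FiniteExtensionInertiallyGenerated.of_tameTower_galois`) the fact rests on
exactly two named facts, both the subject of their own decompositions:
`Kuhlmann2010TameTowerReduction` (the ramification group is a `p`-group; pp. 18–19) and
`Kuhlmann2010GaloisDegreePDefectless` (Cor. 4.2, the heart of §4). Everything here is PROVED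
composition; no statement is changed.

## Sources

* F.-V. Kuhlmann, Trans. AMS 362 (2010) = arXiv:1003.5678: §1.1, §4 (Cor. 4.2), §5 (proof of
  (R4), pp. 18–20; Lemma 5.5).
-/

noncomputable section

namespace Literature.AlgebraicGeometry.Resolution

universe u

/-- **Lemma 5.5 (as applied on p. 20) from the displayed statement of p. 19 alone**: Hensel's
Lemma being PROVED (`Kuhlmann2010HenselsLemma_holds`), `Kuhlmann2010FiniteExtensionInertiallyGenerated`
follows from `Kuhlmann2010NoImmediateExtensionRT`. PROVED (composition).
[cite: Kuhlmann2010, Lemma 5.5 (proof, Case II, p. 19)] -/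
theorem Kuhlmann2010FiniteExtensionInertiallyGenerated.of_noImmediateExtension
    (hε : Kuhlmann2010NoImmediateExtensionRT.{u}) :
    Kuhlmann2010FiniteExtensionInertiallyGenerated.{u} :=
  Kuhlmann2010FiniteExtensionInertiallyGenerated.of_parts hε Kuhlmann2010HenselsLemma_holds

/-- **The remaining trust base of Lemma 5.5 (as applied on p. 20)**: the reduction to a tower
of normal extensions of degree `p` over a finite unramified extension
(`Kuhlmann2010TameTowerReduction`, pp. 18–19 with Lemma 2.27) and Cor. 4.2
(`Kuhlmann2010GaloisDegreePDefectless`). PROVED (composition of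
`Kuhlmann2010NoImmediateExtensionRT.of_parts₂`, `Kuhlmann2010NormalDegreePDefectless.of_galois`
and `of_noImmediateExtension`). [cite: Kuhlmann2010, Section 5, proof of (R4) (pp. 18–20) and Lemma 5.5] -/
theorem Kuhlmann2010FiniteExtensionInertiallyGenerated.of_tameTower_galois
    (hα : Kuhlmann2010TameTowerReduction.{u}) (h42 : Kuhlmann2010GaloisDegreePDefectless.{u}) :
    Kuhlmann2010FiniteExtensionInertiallyGenerated.{u} :=
  Kuhlmann2010FiniteExtensionInertiallyGenerated.of_noImmediateExtension
    (Kuhlmann2010NoImmediateExtensionRT.of_parts₂ hα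
      (Kuhlmann2010NormalDegreePDefectless.of_galois h42))

end Literature.AlgebraicGeometry.Resolution
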